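import Literature.NumberTheory.Rogawski1990.RationalClassesInjectAdelicallySingular
import Literature.NumberTheory.Rogawski1990.CartanRealisation
import Literature.NumberTheory.Automorphic.LocalHermitianPlaneCongruence
import HarnessLib

/-!
# Local conjugacy at a SINGULAR semisimple class: block-by-block congruence in the frame ⇒ a `γ`-centralising congruence ⇒
# `U(H)(F_v)`-conjugacy; at a non-split place the rank-2 block's determinant class mod norms decides (Rogawski 1990, §3.8)

Topic `NumberTheory/Rogawski1990`; namespace `Literature.NumberTheory.Rogawski1990`.  THEOREMS ONLY (no definition, no named fact,
no instance, no notation, no `sorry`).  Cell `pub/hodgecm-mathlib`, ENGINE T1 (crux H413 = `stmt-HodgeConjecture-24833`), row O7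
«singular semisimple classes», piece **(P1-s)** of A-p01's CENSUS-O7 v3 §3 = FILE B over ★ FILE A `Automorphic/LocalHermitianPlaneCongruence`
(local-coefficient rank-2 classification): the LOCAL twin of ★ `exists_commute_twistGram_eq_of_singular_frame`
(`RationalClassesInjectAdelicallySingular`, where the descent `𝔸_L ⇝ L` is Landherr–Hasse); here everything happens over ONE
ring `R` (§1, any commutative ring with involution) resp. over the local ring `E_v = E ⊗_F F_v` at a non-split place (§2).
HC_CM is proved only modulo the printed citations until rung 0 closes.

THE MATHEMATICS [Rogawski1990, §3.8 Prop. 3.8.1 (d) p. 30; §3.1 p. 19].  `γ` singular non-central with an adapted frame `P`: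
`γ P = P (a·1₂ ⊕ b·1₁)`, `a − b` a unit.  For two hermitian `G, G′` whose frame transforms `ᵗ(σP) G P = G_a ⊕ G_b`, `ᵗ(σP) G′ P = G′_a ⊕ G′_b`
are block diagonal (e.g. `G = H_g`, `G′ = H_{g′}` for conjugators `g, g′` of `γ` into `U(H)(R)`: `H⁻¹ H_g ∈ Z(γ)`, ★ `commute_inv_mul_twistGram`,
then ★ `eq_finSum_of_commute`), BLOCKWISE congruences `ᵗ(σ t_a) G_a t_a = G′_a`, `ᵗ(σ t_b) G_b t_b = G′_b` assemble to
`t := P (t_a ⊕ t_b) P⁻¹`, which COMMUTES WITH `γ` and has `ᵗ(σt) G t = G′` (§1 `exists_commute_twistGram_eq_of_blocks`); with ★ R1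
`exists_unitary_conj_of_twistGram_eq` this is `U(H)(R)`-conjugacy of `g γ g⁻¹` and `g′ γ g′⁻¹` (§1 `exists_unitary_conj_of_blocks`).
Over `R = E_v` at a NON-SPLIT finite place the rank-2 congruence is ★ FILE A `exists_formCongr_eq_of_det_eq_mul_norm` (same determinant class
mod `N(E_vˣ)`) and the rank-1 congruence is a scalar `z` with `G′_b = N(z) G_b` — §2 **`exists_commute_twistGram_eq_of_det_blocks`** and
**`exists_unitary_conj_of_det_blocks`**: «same block-determinant classes ⇒ `U(H)(F_v)`-conjugate».

## References
* [Rogawski1990] J. D. Rogawski, *Automorphic Representations of Unitary Groups in Three Variables*, Ann. of Math. Stud. 123 (1990), §3.1 p. 19,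
  §3.8 Prop. 3.8.1 p. 30 (`𝓡(G′_{γ′}∕F_v)`, `F_v^*∕NE_v^*`).
* [Kottwitz1986] R. E. Kottwitz, *Stable trace formula: elliptic singular terms*, Math. Ann. 275 (1986), §7, §9.
* [Jacobowitz1962] R. Jacobowitz, *Hermitian forms over local fields*, Amer. J. Math. 84 (1962), §3 Thm. 3.1.
-/

set_option autoImplicit false

noncomputable section

open NumberField IsDedekindDomain Matrix
open scoped MatrixGroups

namespace Literature.NumberTheory.Rogawski1990

open Literature.NumberTheory.Automorphic
open Literature.NumberTheory.Automorphic.UnitaryGroup (finSum finSum_map eq_finSum_of_commute finSum_commute_finSum_smul_one det_finSum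
  transpose_finSum_map hermForm)
open Literature.AlgebraicGeometry.ShimuraVarieties (unitaryGroup)

/-! ## §1 Ring-generic: blockwise congruences in the frame assemble to a `γ`-centralising congruence -/

section Blocks

variable {S : Type*} [CommRing S] (σ : S →+* S) {N₁ N₂ : ℕ}

/-- `(A ⊕ᶠ B)(C ⊕ᶠ D) = AC ⊕ᶠ BD`. [folklore] -/
private theorem finSum_mul_finSum' (A C : Matrix (Fin N₁) (Fin N₁) S) (B D : Matrix (Fin N₂) (Fin N₂) S) :
    finSum N₁ N₂ A B * finSum N₁ N₂ C D = finSum N₁ N₂ (A * C) (B * D) := by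
  simp only [finSum, Matrix.reindex_apply, Matrix.submatrix_mul_equiv, Matrix.fromBlocks_multiply, Matrix.mul_zero, Matrix.zero_mul,
    add_zero, zero_add]

/-- `1 ⊕ᶠ 1 = 1`. [folklore] -/
private theorem finSum_one_one'' : finSum N₁ N₂ (1 : Matrix (Fin N₁) (Fin N₁) S) (1 : Matrix (Fin N₂) (Fin N₂) S) = 1 := by
  simp only [finSum, Matrix.fromBlocks_one, Matrix.reindex_apply, Matrix.submatrix_one_equiv]

/-- The block-diagonal unit `t₁ ⊕ᶠ t₂ ∈ GL_{N₁+N₂}` of two units. [folklore] -/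
private theorem exists_units_finSum (t₁ : GL (Fin N₁) S) (t₂ : GL (Fin N₂) S) :
    ∃ T : GL (Fin (N₁ + N₂)) S, (T : Matrix (Fin (N₁ + N₂)) (Fin (N₁ + N₂)) S) =
      finSum N₁ N₂ (t₁ : Matrix (Fin N₁) (Fin N₁) S) (t₂ : Matrix (Fin N₂) (Fin N₂) S) :=
  ⟨⟨finSum N₁ N₂ (t₁ : Matrix (Fin N₁) (Fin N₁) S) (t₂ : Matrix (Fin N₂) (Fin N₂) S),
    finSum N₁ N₂ ((t₁⁻¹ : GL (Fin N₁) S) : Matrix (Fin N₁) (Fin N₁) S) ((t₂⁻¹ : GL (Fin N₂) S) : Matrix (Fin N₂) (Fin N₂) S),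
    by rw [finSum_mul_finSum', ← Units.val_mul, ← Units.val_mul, mul_inv_cancel, mul_inv_cancel, Units.val_one, Units.val_one, finSum_one_one''],
    by rw [finSum_mul_finSum', ← Units.val_mul, ← Units.val_mul, inv_mul_cancel, inv_mul_cancel, Units.val_one, Units.val_one, finSum_one_one'']⟩,
    rfl⟩

/-- `twistGram` of block-diagonal data is block diagonal. [folklore] -/
private theorem twistGram_finSum_finSum' (J₁ t₁ : Matrix (Fin N₁) (Fin N₁) S) (J₂ t₂ : Matrix (Fin N₂) (Fin N₂) S) :
    twistGram σ (finSum N₁ N₂ J₁ J₂) (finSum N₁ N₂ t₁ t₂) = finSum N₁ N₂ (twistGram σ J₁ t₁) (twistGram σ J₂ t₂) := by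
  rw [twistGram_def, transpose_finSum_map, finSum_mul_finSum', finSum_mul_finSum', twistGram_def, twistGram_def]

/-- **BLOCKWISE CONGRUENCES IN AN ADAPTED FRAME ASSEMBLE TO A `γ`-CENTRALISING CONGRUENCE** (any commutative ring `S` with a ring
endomorphism `σ`).  Frame `P ∈ GL_{N₁+N₂}(S)` with `γ P = P (a·1 ⊕ᶠ b·1)`; hermitian data `G, G′` block diagonal in the frame,
`ᵗ(σP) G P = G₁ ⊕ᶠ G₂`, `ᵗ(σP) G′ P = G′₁ ⊕ᶠ G′₂`; blockwise congruences `ᵗ(σt₁) G₁ t₁ = G′₁`, `ᵗ(σt₂) G₂ t₂ = G′₂`.  Then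
`t := P (t₁ ⊕ᶠ t₂) P⁻¹` commutes with `γ` and `ᵗ(σt) G t = G′`. [cite: Rogawski1990, §3.8 Prop. 3.8.1 p. 30] [cite: Kottwitz1986, §7] -/
theorem exists_commute_twistGram_eq_of_blocks {γ G G' : Matrix (Fin (N₁ + N₂)) (Fin (N₁ + N₂)) S} {P : GL (Fin (N₁ + N₂)) S} {a b : S}
    (hγP : γ * (P : Matrix (Fin (N₁ + N₂)) (Fin (N₁ + N₂)) S) =
      (P : Matrix (Fin (N₁ + N₂)) (Fin (N₁ + N₂)) S) * finSum N₁ N₂ (a • (1 : Matrix (Fin N₁) (Fin N₁) S)) (b • (1 : Matrix (Fin N₂) (Fin N₂) S)))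
    {G₁ G'₁ : Matrix (Fin N₁) (Fin N₁) S} {G₂ G'₂ : Matrix (Fin N₂) (Fin N₂) S}
    (hGP : twistGram σ G (P : Matrix (Fin (N₁ + N₂)) (Fin (N₁ + N₂)) S) = finSum N₁ N₂ G₁ G₂)
    (hG'P : twistGram σ G' (P : Matrix (Fin (N₁ + N₂)) (Fin (N₁ + N₂)) S) = finSum N₁ N₂ G'₁ G'₂)
    (t₁ : GL (Fin N₁) S) (ht₁ : twistGram σ G₁ (t₁ : Matrix (Fin N₁) (Fin N₁) S) = G'₁)
    (t₂ : GL (Fin N₂) S) (ht₂ : twistGram σ G₂ (t₂ : Matrix (Fin N₂) (Fin N₂) S) = G'₂) :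
    ∃ t : GL (Fin (N₁ + N₂)) S, (t : Matrix (Fin (N₁ + N₂)) (Fin (N₁ + N₂)) S) * γ = γ * (t : Matrix (Fin (N₁ + N₂)) (Fin (N₁ + N₂)) S) ∧
      twistGram σ G (t : Matrix (Fin (N₁ + N₂)) (Fin (N₁ + N₂)) S) = G' := by
  obtain ⟨T, hT⟩ := exists_units_finSum t₁ t₂
  set Pm : Matrix (Fin (N₁ + N₂)) (Fin (N₁ + N₂)) S := (P : Matrix (Fin (N₁ + N₂)) (Fin (N₁ + N₂)) S) with hPm
  set Pi : Matrix (Fin (N₁ + N₂)) (Fin (N₁ + N₂)) S := ((P⁻¹ : GL (Fin (N₁ + N₂)) S) : Matrix (Fin (N₁ + N₂)) (Fin (N₁ + N₂)) S) with hPi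
  have hPiPm : Pi * Pm = 1 := Units.inv_mul P
  have hPmPi : Pm * Pi = 1 := Units.mul_inv P
  set D : Matrix (Fin (N₁ + N₂)) (Fin (N₁ + N₂)) S := finSum N₁ N₂ (a • (1 : Matrix (Fin N₁) (Fin N₁) S)) (b • (1 : Matrix (Fin N₂) (Fin N₂) S))
    with hD
  -- `γ = P D P⁻¹`
  have hγ : γ = Pm * D * Pi := by
    rw [← hγP, Matrix.mul_assoc, hPmPi, Matrix.mul_one]
  refine ⟨P * T * P⁻¹, ?_, ?_⟩
  · -- commutation: `P T P⁻¹ · P D P⁻¹ = P (T D) P⁻¹ = P (D T) P⁻¹`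
    have hTD : (T : Matrix (Fin (N₁ + N₂)) (Fin (N₁ + N₂)) S) * D = D * (T : Matrix (Fin (N₁ + N₂)) (Fin (N₁ + N₂)) S) := by
      rw [hT, hD]
      exact finSum_commute_finSum_smul_one a b _ _
    rw [Units.val_mul, Units.val_mul, hγ]
    calc Pm * (T : Matrix (Fin (N₁ + N₂)) (Fin (N₁ + N₂)) S) * Pi * (Pm * D * Pi)
        = Pm * ((T : Matrix (Fin (N₁ + N₂)) (Fin (N₁ + N₂)) S) * ((Pi * Pm) * D)) * Pi := by simp only [Matrix.mul_assoc]
      _ = Pm * (D * ((Pi * Pm) * (T : Matrix (Fin (N₁ + N₂)) (Fin (N₁ + N₂)) S))) * Pi := by rw [hPiPm, Matrix.one_mul, Matrix.one_mul, hTD]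
      _ = Pm * D * Pi * (Pm * (T : Matrix (Fin (N₁ + N₂)) (Fin (N₁ + N₂)) S) * Pi) := by simp only [Matrix.mul_assoc]
  · -- the congruence: `ᵗσ(P T P⁻¹) G (P T P⁻¹) = ᵗσ(P⁻¹) [ᵗσT (ᵗσP G P) T] P⁻¹ = ᵗσ(P⁻¹) (ᵗσP G′ P) P⁻¹ = G′`
    have hmid : twistGram σ G (Pm * (T : Matrix (Fin (N₁ + N₂)) (Fin (N₁ + N₂)) S)) = twistGram σ G' Pm := by
      rw [twistGram_mul, hGP, hT, ← twistGram_def, twistGram_finSum_finSum', ht₁, ht₂, hG'P]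
    rw [Units.val_mul, Units.val_mul, twistGram_mul, hmid, ← twistGram_mul, hPmPi, twistGram_one]

/-- **… hence `U(H)(R)`-CONJUGACY**: if `G = H_g`, `G′ = H_{g′}` are the transported forms of two conjugators (`g γ g⁻¹ = δ`, `g′ γ g′⁻¹ = δ′`),
the blockwise congruences give `u ∈ U(H)(R)` with `u δ′ u⁻¹ = δ` (★ R1 `exists_unitary_conj_of_twistGram_eq` with `t` from
`exists_commute_twistGram_eq_of_blocks`). [cite: Rogawski1990, §3.1 p. 19; §3.8 Prop. 3.8.1 p. 30] [cite: Kottwitz1986, §7] -/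
theorem exists_unitary_conj_of_blocks (H : Matrix (Fin (N₁ + N₂)) (Fin (N₁ + N₂)) S) {γ δ δ' g g' P : GL (Fin (N₁ + N₂)) S} {a b : S}
    (hg : g * γ * g⁻¹ = δ) (hg' : g' * γ * g'⁻¹ = δ')
    (hγP : (γ : Matrix (Fin (N₁ + N₂)) (Fin (N₁ + N₂)) S) * (P : Matrix (Fin (N₁ + N₂)) (Fin (N₁ + N₂)) S) =
      (P : Matrix (Fin (N₁ + N₂)) (Fin (N₁ + N₂)) S) * finSum N₁ N₂ (a • (1 : Matrix (Fin N₁) (Fin N₁) S)) (b • (1 : Matrix (Fin N₂) (Fin N₂) S)))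
    {G₁ G'₁ : Matrix (Fin N₁) (Fin N₁) S} {G₂ G'₂ : Matrix (Fin N₂) (Fin N₂) S}
    (hGP : twistGram σ (twistGram σ H (g : Matrix (Fin (N₁ + N₂)) (Fin (N₁ + N₂)) S)) (P : Matrix (Fin (N₁ + N₂)) (Fin (N₁ + N₂)) S) =
      finSum N₁ N₂ G₁ G₂)
    (hG'P : twistGram σ (twistGram σ H (g' : Matrix (Fin (N₁ + N₂)) (Fin (N₁ + N₂)) S)) (P : Matrix (Fin (N₁ + N₂)) (Fin (N₁ + N₂)) S) =
      finSum N₁ N₂ G'₁ G'₂)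
    (t₁ : GL (Fin N₁) S) (ht₁ : twistGram σ G₁ (t₁ : Matrix (Fin N₁) (Fin N₁) S) = G'₁)
    (t₂ : GL (Fin N₂) S) (ht₂ : twistGram σ G₂ (t₂ : Matrix (Fin N₂) (Fin N₂) S) = G'₂) :
    ∃ u : GL (Fin (N₁ + N₂)) S, u ∈ unitaryGroup σ H ∧ u * δ' * u⁻¹ = δ := by
  obtain ⟨t, htγ, htG⟩ := exists_commute_twistGram_eq_of_blocks σ hγP hGP hG'P t₁ ht₁ t₂ ht₂
  refine exists_unitary_conj_of_twistGram_eq σ H hg hg' (Units.ext htγ) ?_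
  rw [Units.val_mul, twistGram_mul, ← twistGram_def, htG]

/-- `⊕ᶠ` is injective in the pair of blocks. [folklore] -/
private theorem finSum_injective₂' {A C : Matrix (Fin N₁) (Fin N₁) S} {B D : Matrix (Fin N₂) (Fin N₂) S}
    (h : finSum N₁ N₂ A B = finSum N₁ N₂ C D) : A = C ∧ B = D := by
  have h' := (Matrix.reindex finSumFinEquiv finSumFinEquiv).injective h
  rw [Matrix.fromBlocks_inj] at h'
  exact ⟨h'.1, h'.2.2.2⟩

/-- **THE FRAME BLOCK-DIAGONALISES EVERY `G` WITH `H⁻¹G ∈ Z(γ)`**: if `ᵗ(σP) H P = H₁ ⊕ᶠ H₂`, `γ P = P (a·1 ⊕ᶠ b·1)` with `a − b` a unit and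
`H⁻¹ G` commutes with `γ` (`H` invertible), then `ᵗ(σP) G P = H₁y₁ ⊕ᶠ H₂y₂` is block diagonal (`y = P⁻¹ (H⁻¹G) P ∈ Z(a·1 ⊕ᶠ b·1)` is, ★
`eq_finSum_of_commute`). For `G = H_g`, `g γ g⁻¹ ∈ U(H)`: ★ `commute_inv_mul_twistGram`. [cite: Rogawski1990, §3.8 Prop. 3.8.1 p. 30] -/
theorem exists_twistGram_frame_eq_finSum {H γ G : Matrix (Fin (N₁ + N₂)) (Fin (N₁ + N₂)) S} (hH : IsUnit H.det) {P : GL (Fin (N₁ + N₂)) S}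
    {a b : S} (hab : IsUnit (a - b)) {H₁ : Matrix (Fin N₁) (Fin N₁) S} {H₂ : Matrix (Fin N₂) (Fin N₂) S}
    (hP : twistGram σ H (P : Matrix (Fin (N₁ + N₂)) (Fin (N₁ + N₂)) S) = finSum N₁ N₂ H₁ H₂)
    (hγP : γ * (P : Matrix (Fin (N₁ + N₂)) (Fin (N₁ + N₂)) S) =
      (P : Matrix (Fin (N₁ + N₂)) (Fin (N₁ + N₂)) S) * finSum N₁ N₂ (a • (1 : Matrix (Fin N₁) (Fin N₁) S)) (b • (1 : Matrix (Fin N₂) (Fin N₂) S)))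
    (hx : H⁻¹ * G * γ = γ * (H⁻¹ * G)) :
    ∃ (y₁ : Matrix (Fin N₁) (Fin N₁) S) (y₂ : Matrix (Fin N₂) (Fin N₂) S),
      twistGram σ G (P : Matrix (Fin (N₁ + N₂)) (Fin (N₁ + N₂)) S) = finSum N₁ N₂ (H₁ * y₁) (H₂ * y₂) := by
  set Pm : Matrix (Fin (N₁ + N₂)) (Fin (N₁ + N₂)) S := (P : Matrix (Fin (N₁ + N₂)) (Fin (N₁ + N₂)) S) with hPm
  set Pi : Matrix (Fin (N₁ + N₂)) (Fin (N₁ + N₂)) S := ((P⁻¹ : GL (Fin (N₁ + N₂)) S) : Matrix (Fin (N₁ + N₂)) (Fin (N₁ + N₂)) S) with hPi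
  have hPiPm : Pi * Pm = 1 := Units.inv_mul P
  have hPmPi : Pm * Pi = 1 := Units.mul_inv P
  set D : Matrix (Fin (N₁ + N₂)) (Fin (N₁ + N₂)) S := finSum N₁ N₂ (a • (1 : Matrix (Fin N₁) (Fin N₁) S)) (b • (1 : Matrix (Fin N₂) (Fin N₂) S))
    with hD
  have hD' : Pi * γ * Pm = D := by rw [Matrix.mul_assoc, hγP, ← Matrix.mul_assoc, hPiPm, Matrix.one_mul]
  -- `y := P⁻¹ (H⁻¹ G) P` commutes with `D`
  have hy : Pi * (H⁻¹ * G) * Pm * D = D * (Pi * (H⁻¹ * G) * Pm) := by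
    rw [← hD']
    calc Pi * (H⁻¹ * G) * Pm * (Pi * γ * Pm) = Pi * ((H⁻¹ * G) * ((Pm * Pi) * γ)) * Pm := by simp only [Matrix.mul_assoc]
      _ = Pi * (γ * ((Pm * Pi) * (H⁻¹ * G))) * Pm := by rw [hPmPi, Matrix.one_mul, Matrix.one_mul, hx]
      _ = Pi * γ * Pm * (Pi * (H⁻¹ * G) * Pm) := by simp only [Matrix.mul_assoc]
  obtain ⟨y₁, y₂, hy₁₂⟩ := eq_finSum_of_commute hab _ hy
  refine ⟨y₁, y₂, ?_⟩
  -- `ᵗ(σP) G P = (ᵗ(σP) H P) · (P⁻¹ H⁻¹ G P)`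
  have hHH : H * H⁻¹ = 1 := Matrix.mul_nonsing_inv H hH
  calc twistGram σ G Pm = twistGram σ H Pm * (Pi * (H⁻¹ * G) * Pm) := by
          rw [twistGram_def, twistGram_def]
          calc (Pm.map σ)ᵀ * G * Pm = (Pm.map σ)ᵀ * ((H * (Pm * Pi) * H⁻¹) * G) * Pm := by
                rw [hPmPi, Matrix.mul_one, hHH, Matrix.one_mul]
            _ = (Pm.map σ)ᵀ * H * Pm * (Pi * (H⁻¹ * G) * Pm) := by simp only [Matrix.mul_assoc]
    _ = finSum N₁ N₂ (H₁ * y₁) (H₂ * y₂) := by rw [hP, hy₁₂, finSum_mul_finSum']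

/-- The blocks of a hermitian block-diagonal matrix are hermitian. [folklore] -/
private theorem blocks_hermitian {G₁ : Matrix (Fin N₁) (Fin N₁) S} {G₂ : Matrix (Fin N₂) (Fin N₂) S}
    (h : ((finSum N₁ N₂ G₁ G₂).map σ)ᵀ = finSum N₁ N₂ G₁ G₂) : (G₁.map σ)ᵀ = G₁ ∧ (G₂.map σ)ᵀ = G₂ := by
  rw [transpose_finSum_map] at h
  exact finSum_injective₂' h

/-- A `1 × 1` congruence by a unit scalar: `ᵗ(σ(z·1)) G (z·1) = (σz·z) G`. [folklore] -/
private theorem exists_units_twistGram_eq_smul {G G' : Matrix (Fin N₂) (Fin N₂) S} (h : ∃ z : S, IsUnit z ∧ G' = (σ z * z) • G) :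
    ∃ t : GL (Fin N₂) S, twistGram σ G (t : Matrix (Fin N₂) (Fin N₂) S) = G' := by
  obtain ⟨z, ⟨u, rfl⟩, rfl⟩ := h
  refine ⟨⟨(u : S) • (1 : Matrix (Fin N₂) (Fin N₂) S), ((u⁻¹ : Sˣ) : S) • (1 : Matrix (Fin N₂) (Fin N₂) S), ?_, ?_⟩, ?_⟩
  · rw [Matrix.smul_mul, Matrix.one_mul, smul_smul, Units.mul_inv, one_smul]
  · rw [Matrix.smul_mul, Matrix.one_mul, smul_smul, Units.inv_mul, one_smul]
  · change twistGram σ G ((u : S) • (1 : Matrix (Fin N₂) (Fin N₂) S)) = _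
    rw [twistGram_def, Matrix.map_smul' _ _ _ (map_mul σ), Matrix.map_one _ (map_zero σ) (map_one σ), Matrix.transpose_smul,
      Matrix.transpose_one, Matrix.smul_mul, Matrix.one_mul, Matrix.mul_smul, Matrix.mul_one, smul_smul, mul_comm]

end Blocks

/-! ## §2 Over `E_v` at a non-split finite place: the determinant classes of the blocks decide -/

section Local

variable {F : Type} (E : Type) [Field F] [NumberField F] [Field E] [NumberField E] [Algebra F E]
  [Algebra.IsQuadraticExtension F E] (v : HeightOneSpectrum (𝓞 F)) (c : E ≃ₐ[F] E) {δ : E} (hcδ : c δ = -δ) (hδ : δ ≠ 0)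

open Literature.NumberTheory.Automorphic.UnitaryGroup

include hcδ hδ in
/-- **SAME BLOCK-DETERMINANT CLASSES ⇒ A `γ`-CENTRALISING CONGRUENCE over `E_v`, `v` NON-SPLIT.**  `R = E_v = E ⊗_F F_v` (a field with
involution `σ = c ⊗ 1`, fixed field `F_v`), frame `P` of `γ` (`γ P = P (a·1₂ ⊕ᶠ b·1₁)`), hermitian invertible `G, G′` block diagonal in the frame
with blocks `G₁ ⊕ᶠ G₂`, `G′₁ ⊕ᶠ G′₂` (rank `2 ⊕ 1`).  If `det G′₁ ≡ det G₁` and `G′₂ ≡ G₂ (mod N(E_vˣ))` then some `t ∈ GL₃(E_v)` commutes with `γ`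
and `ᵗ(σt) G t = G′`: the rank-2 congruence is ★ `exists_formCongr_eq_of_det_eq_mul_norm` (binary hermitian forms over `E_v∕F_v` are classified
by the determinant class — every `F_v`-unit class is a value), the rank-1 congruence is the scalar `z`, assembled by `exists_commute_twistGram_eq_of_blocks`.
[cite: Rogawski1990, §3.8 Prop. 3.8.1 (d) p. 30] [cite: Jacobowitz1962, §3 Thm. 3.1] -/
theorem exists_commute_twistGram_eq_of_det_blocks (w : PlacesOver E v) (hw : c • w.1 = w.1)
    {γ G G' : Matrix (Fin (2 + 1)) (Fin (2 + 1)) (LocalRing E v)} {P : GL (Fin (2 + 1)) (LocalRing E v)} {a b : LocalRing E v}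
    (hG : (G.map (conjLocal E c v))ᵀ = G) (hG' : (G'.map (conjLocal E c v))ᵀ = G') (hGd : IsUnit G.det) (hG'd : IsUnit G'.det)
    (hγP : γ * P.val = P.val *
      finSum 2 1 (a • (1 : Matrix (Fin 2) (Fin 2) (LocalRing E v))) (b • (1 : Matrix (Fin 1) (Fin 1) (LocalRing E v))))
    {G₁ G'₁ : Matrix (Fin 2) (Fin 2) (LocalRing E v)} {G₂ G'₂ : Matrix (Fin 1) (Fin 1) (LocalRing E v)}
    (hGP : twistGram (conjLocal E c v) G P.val = finSum 2 1 G₁ G₂)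
    (hG'P : twistGram (conjLocal E c v) G' P.val = finSum 2 1 G'₁ G'₂)
    (hdet₁ : ∃ z : LocalRing E v, IsUnit z ∧ G'₁.det = G₁.det * (conjLocal E c v z * z))
    (hdet₂ : ∃ z : LocalRing E v, IsUnit z ∧ G'₂ = (conjLocal E c v z * z) • G₂) :
    ∃ t : GL (Fin (2 + 1)) (LocalRing E v),
      t.val * γ = γ * t.val ∧
        twistGram (conjLocal E c v) G t.val = G' := by
  have hσ : ∀ x, conjLocal E c v (conjLocal E c v x) = x := Liu2021.LemD1OfPlace.conjLocal_conjLocal_apply E v c hcδ hδ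
  -- the blocks are hermitian with unit determinants
  have hPG : ((twistGram (conjLocal E c v) G P.val).map (conjLocal E c v))ᵀ =
      twistGram (conjLocal E c v) G P.val := conjTranspose_twistGram _ _ hσ hG _
  have hPG' : ((twistGram (conjLocal E c v) G' P.val).map (conjLocal E c v))ᵀ =
      twistGram (conjLocal E c v) G' P.val := conjTranspose_twistGram _ _ hσ hG' _
  rw [hGP] at hPG
  rw [hG'P] at hPG'
  have h₁ := (blocks_hermitian (conjLocal E c v) hPG).1
  have h'₁ := (blocks_hermitian (conjLocal E c v) hPG').1
  have hdG : G₁.det * G₂.det = conjLocal E c v P.val.det * G.det *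
      P.val.det := by rw [← det_finSum, ← hGP, det_twistGram]
  have hdG' : G'₁.det * G'₂.det = conjLocal E c v P.val.det * G'.det *
      P.val.det := by rw [← det_finSum, ← hG'P, det_twistGram]
  have hPd : IsUnit P.val.det := Matrix.isUnits_det_units P
  have hG₁d : IsUnit G₁.det := isUnit_of_mul_isUnit_left (hdG ▸ ((hPd.map (conjLocal E c v)).mul hGd).mul hPd)
  have hG'₁d : IsUnit G'₁.det := isUnit_of_mul_isUnit_left (hdG' ▸ ((hPd.map (conjLocal E c v)).mul hG'd).mul hPd)
  -- rank 2: ★ FILE A; rank 1: the scalar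
  obtain ⟨t₁, ht₁⟩ := exists_formCongr_eq_of_det_eq_mul_norm E v c hcδ hδ w hw h₁ h'₁ hG₁d hG'₁d hdet₁
  obtain ⟨t₂, ht₂⟩ := exists_units_twistGram_eq_smul (conjLocal E c v) hdet₂
  exact exists_commute_twistGram_eq_of_blocks (conjLocal E c v) hγP hGP hG'P t₁ (by rw [twistGram_def]; exact ht₁) t₂ ht₂

include hcδ hδ in
/-- **LOCAL CONJUGACY AT A SINGULAR CLASS: SAME RANK-2 BLOCK-DETERMINANT CLASS ⇒ `U(H)(F_v)`-CONJUGATE** (`v` non-split).  `H` hermitian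
invertible over `E_v`, `γ` with frame `P` (`γ P = P (a·1₂ ⊕ᶠ b·1₁)`), conjugators `g γ g⁻¹ = δ`, `g′ γ g′⁻¹ = δ′` whose transported forms
`H_g = ᵗ(σg) H g`, `H_{g′}` are block diagonal in the frame (automatic when `δ, δ′ ∈ U(H)`: `exists_twistGram_frame_eq_finSum`), with rank-2 blocks
`G₁`, `G′₁`.  If `det G′₁ = det G₁ · N(z)` for a unit `z` — the class in `F_v^× ∕ N E_v^×` of [Rogawski1990, 3.8.1 (d)] — then `δ′ = u⁻¹ δ u` for some
`u ∈ U(H)(F_v)`.  The rank-1 classes then agree automatically (determinant bookkeeping `det H_g = N(det g) det H`), and ★ R1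
`exists_unitary_conj_of_twistGram_eq` converts the `γ`-centralising congruence into conjugacy. [cite: Rogawski1990, §3.8 Prop. 3.8.1 (d) p. 30; §3.1 p. 19]
[cite: Jacobowitz1962, §3 Thm. 3.1] [cite: Kottwitz1986, §7] -/
theorem exists_unitary_conj_of_det_blocks (w : PlacesOver E v) (hw : c • w.1 = w.1)
    {H : Matrix (Fin (2 + 1)) (Fin (2 + 1)) (LocalRing E v)} (hH : (H.map (conjLocal E c v))ᵀ = H) (hHd : IsUnit H.det)
    {γ δ' δ'' g g' P : GL (Fin (2 + 1)) (LocalRing E v)} {a b : LocalRing E v} (hg : g * γ * g⁻¹ = δ') (hg' : g' * γ * g'⁻¹ = δ'')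
    (hγP : γ.val * P.val =
      P.val *
        finSum 2 1 (a • (1 : Matrix (Fin 2) (Fin 2) (LocalRing E v))) (b • (1 : Matrix (Fin 1) (Fin 1) (LocalRing E v))))
    {G₁ G'₁ : Matrix (Fin 2) (Fin 2) (LocalRing E v)} {G₂ G'₂ : Matrix (Fin 1) (Fin 1) (LocalRing E v)}
    (hGP : twistGram (conjLocal E c v) (twistGram (conjLocal E c v) H g.val)
      P.val = finSum 2 1 G₁ G₂)
    (hG'P : twistGram (conjLocal E c v) (twistGram (conjLocal E c v) H g'.val)
      P.val = finSum 2 1 G'₁ G'₂)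
    (hdet₁ : ∃ z : LocalRing E v, IsUnit z ∧ G'₁.det = G₁.det * (conjLocal E c v z * z)) :
    ∃ u : GL (Fin (2 + 1)) (LocalRing E v), u ∈ unitaryGroup (conjLocal E c v) H ∧ u * δ'' * u⁻¹ = δ' := by
  have hσ : ∀ x, conjLocal E c v (conjLocal E c v x) = x := Liu2021.LemD1OfPlace.conjLocal_conjLocal_apply E v c hcδ hδ
  set gm : Matrix (Fin (2 + 1)) (Fin (2 + 1)) (LocalRing E v) := g.val with hgm
  set g'm : Matrix (Fin (2 + 1)) (Fin (2 + 1)) (LocalRing E v) := g'.val with hg'm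
  set Pm : Matrix (Fin (2 + 1)) (Fin (2 + 1)) (LocalRing E v) := P.val with hPm
  have hgd : IsUnit gm.det := Matrix.isUnits_det_units g
  have hg'd : IsUnit g'm.det := Matrix.isUnits_det_units g'
  have hPd : IsUnit Pm.det := Matrix.isUnits_det_units P
  have hG : ((twistGram (conjLocal E c v) H gm).map (conjLocal E c v))ᵀ = twistGram (conjLocal E c v) H gm := conjTranspose_twistGram _ _ hσ hH _
  have hG' : ((twistGram (conjLocal E c v) H g'm).map (conjLocal E c v))ᵀ = twistGram (conjLocal E c v) H g'm :=
    conjTranspose_twistGram _ _ hσ hH _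
  have hGd : IsUnit (twistGram (conjLocal E c v) H gm).det := by rw [det_twistGram]; exact ((hgd.map (conjLocal E c v)).mul hHd).mul hgd
  have hG'd : IsUnit (twistGram (conjLocal E c v) H g'm).det := by rw [det_twistGram]; exact ((hg'd.map (conjLocal E c v)).mul hHd).mul hg'd
  -- determinant bookkeeping: the rank-1 classes agree
  have hdG : G₁.det * G₂.det = conjLocal E c v Pm.det * (twistGram (conjLocal E c v) H gm).det * Pm.det := by
    rw [← det_finSum, ← hGP, det_twistGram]
  have hdG' : G'₁.det * G'₂.det = conjLocal E c v Pm.det * (twistGram (conjLocal E c v) H g'm).det * Pm.det := by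
    rw [← det_finSum, ← hG'P, det_twistGram]
  have hG₁d : IsUnit G₁.det := isUnit_of_mul_isUnit_left (hdG ▸ ((hPd.map (conjLocal E c v)).mul hGd).mul hPd)
  rw [det_twistGram] at hdG hdG'
  obtain ⟨z, ⟨zu, rfl⟩, hZ⟩ := hdet₁
  set gi : Matrix (Fin (2 + 1)) (Fin (2 + 1)) (LocalRing E v) := (g⁻¹).val with hgi
  have hu : gm.det * gi.det = 1 := by
    rw [← Matrix.det_mul, hgm, hgi, ← Units.val_mul, mul_inv_cancel, Units.val_one, Matrix.det_one]
  have hz : (zu : LocalRing E v) * ((zu⁻¹ : (LocalRing E v)ˣ) : LocalRing E v) = 1 := zu.mul_inv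
  have hsu : conjLocal E c v gm.det * conjLocal E c v gi.det = 1 := by rw [← map_mul, hu, map_one]
  have hsz : conjLocal E c v (zu : LocalRing E v) * conjLocal E c v ((zu⁻¹ : (LocalRing E v)ˣ) : LocalRing E v) = 1 := by
    rw [← map_mul, hz, map_one]
  set ζ : LocalRing E v := g'm.det * gi.det * ((zu⁻¹ : (LocalRing E v)ˣ) : LocalRing E v) with hζ
  have hζU : IsUnit ζ := (hg'd.mul (Matrix.isUnits_det_units g⁻¹)).mul (zu⁻¹).isUnit
  have hσζ : conjLocal E c v ζ = conjLocal E c v g'm.det * conjLocal E c v gi.det * conjLocal E c v ((zu⁻¹ : (LocalRing E v)ˣ) : LocalRing E v) := by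
    rw [hζ, map_mul, map_mul]
  have key : G₁.det * (conjLocal E c v (zu : LocalRing E v) * (zu : LocalRing E v)) * G'₂.det =
      G₁.det * (conjLocal E c v (zu : LocalRing E v) * (zu : LocalRing E v)) * (conjLocal E c v ζ * ζ * G₂.det) := by
    rw [hσζ, hζ]
    linear_combination (-G'₂.det) * hZ + hdG'
      + (-(conjLocal E c v (zu : LocalRing E v) * (zu : LocalRing E v) * conjLocal E c v g'm.det * conjLocal E c v gi.det *
        conjLocal E c v ((zu⁻¹ : (LocalRing E v)ˣ) : LocalRing E v) * g'm.det * gi.det * ((zu⁻¹ : (LocalRing E v)ˣ) : LocalRing E v))) * hdG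
      + (-(conjLocal E c v Pm.det * H.det * Pm.det * conjLocal E c v g'm.det * g'm.det *
          ((zu : LocalRing E v) * ((zu⁻¹ : (LocalRing E v)ˣ) : LocalRing E v)) * (conjLocal E c v gm.det * conjLocal E c v gi.det) *
          (gm.det * gi.det))) * hsz
      + (-(conjLocal E c v Pm.det * H.det * Pm.det * conjLocal E c v g'm.det * g'm.det * (conjLocal E c v gm.det * conjLocal E c v gi.det) *
          (gm.det * gi.det))) * hz
      + (-(conjLocal E c v Pm.det * H.det * Pm.det * conjLocal E c v g'm.det * g'm.det * (gm.det * gi.det))) * hsu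
      + (-(conjLocal E c v Pm.det * H.det * Pm.det * conjLocal E c v g'm.det * g'm.det)) * hu
  have hA : IsUnit (G₁.det * (conjLocal E c v (zu : LocalRing E v) * (zu : LocalRing E v))) :=
    hG₁d.mul ((zu.isUnit.map (conjLocal E c v)).mul zu.isUnit)
  have hdet₂' : G'₂.det = conjLocal E c v ζ * ζ * G₂.det := (IsUnit.mul_right_inj hA).mp key
  have hdet₂ : ∃ z : LocalRing E v, IsUnit z ∧ G'₂ = (conjLocal E c v z * z) • G₂ := by
    refine ⟨ζ, hζU, Matrix.ext fun i j => ?_⟩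
    obtain rfl : i = 0 := Subsingleton.elim _ _
    obtain rfl : j = 0 := Subsingleton.elim _ _
    have e₁ : G'₂ 0 0 = G'₂.det := (Matrix.det_fin_one G'₂).symm
    have e₂ : G₂ 0 0 = G₂.det := (Matrix.det_fin_one G₂).symm
    rw [Matrix.smul_apply, smul_eq_mul, e₁, e₂]
    exact hdet₂'
  -- assemble and convert to conjugacy (★ R1)
  obtain ⟨t, htγ, htG⟩ := exists_commute_twistGram_eq_of_det_blocks E v c hcδ hδ w hw hG hG' hGd hG'd hγP hGP hG'P
    ⟨(zu : LocalRing E v), zu.isUnit, hZ⟩ hdet₂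
  refine exists_unitary_conj_of_twistGram_eq (conjLocal E c v) H hg hg' (Units.ext htγ) ?_
  rw [Units.val_mul, twistGram_mul, ← twistGram_def, htG]

end Local

end Literature.NumberTheory.Rogawski1990

end
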